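import Literature.AlgebraicGeometry.Modules.CechProductCoverUnitKunneth
import Literature.AlgebraicGeometry.Modules.CechUnitModulePairing
import Literature.Algebra.Homology.OrderedCechPairSystemCrossClasses
import Literature.Algebra.Homology.OrderedCechPairSystemCupFrontBack
import Literature.Algebra.Homology.OrderedCechSystemRefineMap
import Literature.Algebra.Homology.OrderedCechSystemCupClasses
import HarnessLib

/-!
# The Künneth cross product on the product cover IS `p₁^* ∪ p₂^*` («cross = p₁♯ ∪ p₂♯»; The Stacks Project, Tag 0BEC)

Layer `Literature/AlgebraicGeometry/Modules`, namespace `Literature.AlgebraicGeometry.Modules`.  THEOREMS ONLY (no definition, no named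
fact, no instance, no notation, no `sorry`).  Cell `hodgecm-mathlib` (D-0151), F-11 ∕ J3 Künneth packet, (G3)∕(iv-4) BRIDGE piece (B-ii)
(B-p06 (g15); algebraic read-outs ★ F0P1a-p02 (g3) `Algebra/Homology/OrderedCechPairSystemCrossTensor` (cross side) and
`…CupFrontBack` (cup side); consumer: the (G3) closer `Modules/CechProductCoverKunnethComponents` of F0P1b-p06 (g2)).

Setting: a span `X ← Z → Y` (`p`, `q`), structure maps with `ρZ = p♯ ∘ ρX = q♯ ∘ ρY` (hypotheses `hρZp`, `hρZq`), covers `𝓤` of `X`,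
`𝓥` of `Y`, the PRODUCT COVER `W₀ (i,j) = p⁻¹U_i ∩ q⁻¹V_j` of `Z` indexed by `ι ×ₗ κ`, the Čech systems `S_X = Γ(𝓤, 𝒪_X)`,
`S_Y = Γ(𝓥, 𝒪_Y)`, `S_Z = Γ(W₀, 𝒪_Z)` (★ `sectionsSystem`), the pull-back data `φ_p : π₁^*S_X ⟶ S_Z`, `φ_q : π₂^*S_Y ⟶ S_Z`
(★ `Modules/CechPullbackSystemHom.pullbackSystemHom`, admissibility `W₀ c ≤ p⁻¹U_{π₁c}`, `≤ q⁻¹V_{π₂c}`), and ANY isomorphism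
`e : Č(lexSystem (S_X ⊠ S_Y)) ≅ Č(W₀, 𝒪_Z)` with simplexwise components `ε_T` satisfying the two clauses of ★ (B-i′)
`Modules/CechProductCoverUnitKunneth.exists_sysComplex_lexSystem_prodSystem_iso_cechComplex_unit` (hypotheses `he`, `hε` — so the closer's
single `obtain` feeds this file):
* §1 ON COCHAINS **`cechUnit_iso_crossComponent_tmul_eq_cup_refineCochain`**: for `0 ≤ a`, `0 ≤ b`, `a + b = n`, `f ∈ Čᵃ(S_X)`, `g ∈ Čᵇ(S_Y)`:
  `eⁿ (× (f ⊗ g)) = (p^♯ f) ∪ (q^♯ g)` ON THE NOSE, where `× (f ⊗ g) = crossComponent (S_X ⊠ S_Y) a b n (tensorCochainEquiv (f ⊗ g))`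
  (Alexander–Whitney), `p^♯ = refineCochain π₁ φ_p`, `q^♯ = refineCochain π₂ φ_q` (★ `OrderedCechSystemAlternating.refineCochain`), `∪` the
  cup product for the multiplication pairing (★ `OrderedCechSystemCup.cup`, ★ `CechUnitModulePairing.mulPairing`): both sides read, at a chain
  `T`, `p♯(f(π₁-front word of T))|_{W₀,T} · q♯(g(π₂-back word of T))|_{W₀,T}` (★ `crossComponent_tensorCochainEquiv_tmul`, `hε`;
  ★ `cup_refineCochain_fst_snd_apply`, `toRing_pullbackSystemHom_app`, `map_altEvalAt`).
* §2 ON CLASSES **`homologyMap_cechUnit_iso_cross_kunnethComponent_eq_cupH`**: `Hⁿ(e) (Hⁿ(totalTensorIso ≫ ×) (κ_{a,b} (y ⊗ z))) =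
  p^*y ∪ q^*z` for classes `y ∈ Ȟᵃ(𝓤, 𝒪_X)`, `z ∈ Ȟᵇ(𝓥, 𝒪_Y)` (`a b n : ℕ`, `a + b = n`; ★ `OrderedCechPairSystemCrossClasses`, ★ `cupH_π`,
  ★ D25 `homologyπ_refineComplexMap`, `cycles_ext` on §1).

HC_CM is proved only modulo the 7 printed citations until rung 0 closes — nothing here bears on a summit statement.

## References
* [StacksProject] The Stacks Project, Tag 0BEC (Künneth formula: the Čech complex of the product cover and the cup product), Tag 01FG,
  Tag 01FP (cup product on Čech cohomology).
* [EilenbergMacLane1953] S. Eilenberg, S. Mac Lane, *On the groups `H(Π,n)`, I*, Ann. of Math. 58 (1953), §5 (Alexander–Whitney map).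
* [GortzWedhorn2023] U. Görtz, T. Wedhorn, *Algebraic Geometry II* (2023), Def. 21.68 (p. 180), (21.29) (cup product on Čech cohomology).
-/

set_option backward.isDefEq.respectTransparency false -- `Scheme.Modules` is not reducible (as in ★ `CechBoxTensorBicomplex`)

noncomputable section

universe u

open CategoryTheory AlgebraicGeometry TopologicalSpace TensorProduct MonoidalCategory Opposite HomologicalComplex
open Literature.Algebra.Homology Literature.Algebra.Homology.OrderedCech

namespace Literature.AlgebraicGeometry.Modules

variable {X Y Z : Scheme.{u}} {p : Z ⟶ X} {q : Z ⟶ Y} {A : Type u} [CommRing A]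
  {ρX : A →+* Γ(X, ⊤)} {ρY : A →+* Γ(Y, ⊤)} {ρZ : A →+* Γ(Z, ⊤)}
  (hρZp : ∀ c, ρZ c = p.appTop (ρX c)) (hρZq : ∀ c, ρZ c = q.appTop (ρY c))
  {ι κ : Type} [LinearOrder ι] [LinearOrder κ] [Fintype ι] [Fintype κ] (𝓤 : ι → X.Opens) (𝓥 : κ → Y.Opens)
  (e : sysComplex (lexSystem (prodSystem (sectionsSystem 𝓤 (unitModule X) ρX) (sectionsSystem 𝓥 (unitModule Y) ρY))) ≅
    cechComplex (fun c : ι ×ₗ κ => p ⁻¹ᵁ 𝓤 (ofLex c).1 ⊓ q ⁻¹ᵁ 𝓥 (ofLex c).2) (unitModule Z) ρZ)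
  (ε : ∀ T : Finset (ι ×ₗ κ), T.Nonempty →
    (SecMod (unitModule X) ρX (cechOpen 𝓤 (fstProj T)) ⊗[A] SecMod (unitModule Y) ρY (cechOpen 𝓥 (sndProj T)) ≃ₗ[A]
      SecMod (unitModule Z) ρZ (cechOpen (fun c : ι ×ₗ κ => p ⁻¹ᵁ 𝓤 (ofLex c).1 ⊓ q ⁻¹ᵁ 𝓥 (ofLex c).2) T)))
  (he : ∀ (n : ℤ) (g : SysCochain (lexSystem (prodSystem (sectionsSystem 𝓤 (unitModule X) ρX)
      (sectionsSystem 𝓥 (unitModule Y) ρY))) n) (σ : Simplex (ι ×ₗ κ) n), ((e.hom.f n).hom g) σ = ε σ.1 σ.2.1 (g σ))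
  (hε : ∀ (T : Finset (ι ×ₗ κ)) (hT : T.Nonempty) (a : SecMod (unitModule X) ρX (cechOpen 𝓤 (fstProj T)))
      (b : SecMod (unitModule Y) ρY (cechOpen 𝓥 (sndProj T))),
      SecMod.toRing ρZ (ε T hT (a ⊗ₜ b)) =
        p.appLE (cechOpen 𝓤 (fstProj T)) _ (le_preimage_left_of_eq_inf (cechOpen_prodCover_eq p q 𝓤 𝓥 T)) (SecMod.toRing ρX a) *
          q.appLE (cechOpen 𝓥 (sndProj T)) _ (le_preimage_right_of_eq_inf (cechOpen_prodCover_eq p q 𝓤 𝓥 T))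
            (SecMod.toRing ρY b))

/-! ## §1 On cochains: `eⁿ (× (f ⊗ g)) = p^♯f ∪ q^♯g` -/

include he hε in
/-- **«cross = p₁♯ ∪ p₂♯» on cochains.**  Under the characterised identification `e` of ★ (B-i′), the Alexander–Whitney cross product of
`f ∈ Čᵃ(𝓤, 𝒪_X)` and `g ∈ Čᵇ(𝓥, 𝒪_Y)` is, ON THE NOSE, the cup product of the pulled-back cochains `p^♯f ∈ Čᵃ(W₀, 𝒪_Z)`, `q^♯g ∈ Čᵇ(W₀, 𝒪_Z)`
on the product cover (both read `p♯(f(π₁-front word of T))| · q♯(g(π₂-back word of T))|` at every chain `T`).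
[cite: StacksProject, Tag 0BEC] [cite: EilenbergMacLane1953, §5] [cite: GortzWedhorn2023, (21.29)] -/
theorem cechUnit_iso_crossComponent_tmul_eq_cup_refineCochain {a b n : ℤ} (h : 0 ≤ a ∧ 0 ≤ b ∧ a + b = n)
    (f : SysCochain (sectionsSystem 𝓤 (unitModule X) ρX) a) (g : SysCochain (sectionsSystem 𝓥 (unitModule Y) ρY) b) :
    (e.hom.f n).hom (crossComponent (prodSystem (sectionsSystem 𝓤 (unitModule X) ρX) (sectionsSystem 𝓥 (unitModule Y) ρY)) a b n
        (tensorCochainEquiv (sectionsSystem 𝓤 (unitModule X) ρX) (sectionsSystem 𝓥 (unitModule Y) ρY) a b (f ⊗ₜ g))) =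
      cup (mulPairing (fun c : ι ×ₗ κ => p ⁻¹ᵁ 𝓤 (ofLex c).1 ⊓ q ⁻¹ᵁ 𝓥 (ofLex c).2) ρZ) a b n
        (refineCochain (fun c : ι ×ₗ κ => (ofLex c).1)
          (pullbackSystemHom p 𝓤 (fun c : ι ×ₗ κ => p ⁻¹ᵁ 𝓤 (ofLex c).1 ⊓ q ⁻¹ᵁ 𝓥 (ofLex c).2) (fun c : ι ×ₗ κ => (ofLex c).1)
            (fun _ => inf_le_left) ρX ρZ hρZp) a f)
        (refineCochain (fun c : ι ×ₗ κ => (ofLex c).2)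
          (pullbackSystemHom q 𝓥 (fun c : ι ×ₗ κ => p ⁻¹ᵁ 𝓤 (ofLex c).1 ⊓ q ⁻¹ᵁ 𝓥 (ofLex c).2) (fun c : ι ×ₗ κ => (ofLex c).2)
            (fun _ => inf_le_right) ρY ρZ hρZq) b g) := by
  funext T
  rw [he, crossComponent_tensorCochainEquiv_tmul h f g T, cup_refineCochain_fst_snd_apply _ _ _ h f g T]
  apply SecMod.toRing_injective ρZ
  rw [hε, toRing_mulPairing, sectionsSystem_map_apply, sectionsSystem_map_apply, SecMod.toRing_res, SecMod.toRing_res,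
    toRing_pullbackSystemHom_app, toRing_pullbackSystemHom_app]
  -- the words of `T` live in the projections of the faces
  have hα : Finset.univ.image (frontWord T.1 (crossCard h T)) ⊆
      (T.1.filter (· ≤ T.1.orderEmbOfFin (crossCard h T) ⟨a.toNat, by omega⟩)).image fun c : ι ×ₗ κ => (ofLex c).1 := by
    intro i hi
    obtain ⟨k, -, rfl⟩ := Finset.mem_image.1 hi
    exact Finset.mem_image.2 ⟨T.1.orderEmbOfFin (crossCard h T) ⟨k, by omega⟩, Finset.mem_filter.2
      ⟨Finset.orderEmbOfFin_mem _ _ _, (T.1.orderEmbOfFin _).monotone (Fin.mk_le_mk.2 (by have := k.2; omega))⟩, rfl⟩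
  have hβ : Finset.univ.image (backWord T.1 (crossCard h T)) ⊆
      (T.1.filter (T.1.orderEmbOfFin (crossCard h T) ⟨a.toNat, by omega⟩ ≤ ·)).image fun c : ι ×ₗ κ => (ofLex c).2 := by
    intro j hj
    obtain ⟨k, -, rfl⟩ := Finset.mem_image.1 hj
    exact Finset.mem_image.2 ⟨T.1.orderEmbOfFin (crossCard h T) ⟨a.toNat + k, by omega⟩, Finset.mem_filter.2
      ⟨Finset.orderEmbOfFin_mem _ _ _, (T.1.orderEmbOfFin _).monotone (Fin.mk_le_mk.2 (Nat.le_add_right _ _))⟩, rfl⟩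
  have hsub₁ : (T.1.filter (· ≤ T.1.orderEmbOfFin (crossCard h T) ⟨a.toNat, by omega⟩)).image (fun c : ι ×ₗ κ => (ofLex c).1) ⊆
      fstProj T.1 := Finset.image_subset_image (Finset.filter_subset _ _)
  have hsub₂ : (T.1.filter (T.1.orderEmbOfFin (crossCard h T) ⟨a.toNat, by omega⟩ ≤ ·)).image (fun c : ι ×ₗ κ => (ofLex c).2) ⊆
      sndProj T.1 := Finset.image_subset_image (Finset.filter_subset _ _)
  rw [← SysCochain.map_altEvalAt f _ _ _ hα hsub₁, ← SysCochain.map_altEvalAt g _ _ _ hβ hsub₂, sectionsSystem_map_apply,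
    sectionsSystem_map_apply, SecMod.toRing_res, SecMod.toRing_res]
  change (X.presheaf.map (homOfLE _).op ≫ p.appLE _ _ _) _ * (Y.presheaf.map (homOfLE _).op ≫ q.appLE _ _ _) _ =
    (p.appLE _ _ _ ≫ Z.presheaf.map (homOfLE _).op) _ * (q.appLE _ _ _ ≫ Z.presheaf.map (homOfLE _).op) _
  rw [Scheme.Hom.map_appLE, Scheme.Hom.map_appLE, Scheme.Hom.appLE_map, Scheme.Hom.appLE_map]

/-! ## §2 On classes: `Hⁿ(e) (Hⁿ(totalTensorIso ≫ ×) (κ_{a,b} (y ⊗ z))) = p^*y ∪ q^*z` -/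

include he hε in
/-- **«cross = p₁^* ∪ p₂^*» on classes.**  For classes `y ∈ Ȟᵃ(𝓤, 𝒪_X)`, `z ∈ Ȟᵇ(𝓥, 𝒪_Y)` (`a + b = n`), the Künneth comparison of ★ F-K3 —
`κ_{a,b}` (★ `KunnethMap.kunnethComponent`, `[z] ⊗ [w] ↦ [z ⊗ w]`), then `Hⁿ(totalTensorIso ≫ ×)` — followed by `Hⁿ(e)` for the characterised
identification `e : Č(lexSystem (S_X ⊠ S_Y)) ≅ Č(W₀, 𝒪_Z)` of ★ (B-i′), is the cup product `p^*y ∪ q^*z` of the pulled-back classes on the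
product cover (★ `cupH` for `mulPairing`, ★ `refineComplexMap` of the pull-back data). [cite: StacksProject, Tag 0BEC] [cite: StacksProject, Tag 01FP]
[cite: EilenbergMacLane1953, §5] [cite: GortzWedhorn2023, (21.29)] -/
theorem homologyMap_cechUnit_iso_cross_kunnethComponent_eq_cupH (a b n : ℕ) (h : a + b = n)
    (y : (cechComplex 𝓤 (unitModule X) ρX).homology (a : ℤ)) (z : (cechComplex 𝓥 (unitModule Y) ρY).homology (b : ℤ)) :
    (HomologicalComplex.homologyMap e.hom (n : ℤ)).hom
      ((HomologicalComplex.homologyMap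
        ((totalTensorIso (sectionsSystem 𝓤 (unitModule X) ρX) (sectionsSystem 𝓥 (unitModule Y) ρY)).hom ≫
          totalDescHom (sysBicomplex (prodSystem (sectionsSystem 𝓤 (unitModule X) ρX) (sectionsSystem 𝓥 (unitModule Y) ρY)))
            (sysComplex (lexSystem (prodSystem (sectionsSystem 𝓤 (unitModule X) ρX) (sectionsSystem 𝓥 (unitModule Y) ρY))))
            (fun a b n => ModuleCat.ofHom (crossComponent (prodSystem (sectionsSystem 𝓤 (unitModule X) ρX)
              (sectionsSystem 𝓥 (unitModule Y) ρY)) a b n))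
            (crossComponent_comm (prodSystem (sectionsSystem 𝓤 (unitModule X) ρX) (sectionsSystem 𝓥 (unitModule Y) ρY))))
        (n : ℤ)).hom
        ((kunnethComponent (cechComplex 𝓤 (unitModule X) ρX) (cechComplex 𝓥 (unitModule Y) ρY) a b n (by omega)).hom (y ⊗ₜ z))) =
      cupH (mulPairing (fun c : ι ×ₗ κ => p ⁻¹ᵁ 𝓤 (ofLex c).1 ⊓ q ⁻¹ᵁ 𝓥 (ofLex c).2) ρZ) (isNaturalPairing_mulPairing _ _) a b n h
        ((HomologicalComplex.homologyMap (refineComplexMap (fun c : ι ×ₗ κ => (ofLex c).1)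
          (pullbackSystemHom p 𝓤 (fun c : ι ×ₗ κ => p ⁻¹ᵁ 𝓤 (ofLex c).1 ⊓ q ⁻¹ᵁ 𝓥 (ofLex c).2) (fun c : ι ×ₗ κ => (ofLex c).1)
            (fun _ => inf_le_left) ρX ρZ hρZp)) (a : ℤ)).hom y)
        ((HomologicalComplex.homologyMap (refineComplexMap (fun c : ι ×ₗ κ => (ofLex c).2)
          (pullbackSystemHom q 𝓥 (fun c : ι ×ₗ κ => p ⁻¹ᵁ 𝓤 (ofLex c).1 ⊓ q ⁻¹ᵁ 𝓥 (ofLex c).2) (fun c : ι ×ₗ κ => (ofLex c).2)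
            (fun _ => inf_le_right) ρY ρZ hρZq)) (b : ℤ)).hom z) := by
  obtain ⟨zy, rfl⟩ := homologyπ_surjective (cechComplex 𝓤 (unitModule X) ρX) a y
  obtain ⟨zz, rfl⟩ := homologyπ_surjective (cechComplex 𝓥 (unitModule Y) ρY) b z
  have hab : (0 : ℤ) ≤ a ∧ (0 : ℤ) ≤ b ∧ (a : ℤ) + b = n := ⟨by omega, by omega, by omega⟩
  -- left: the class of `cyclesMap e (cyclesMap (tti ≫ ×) (zy ⊗ zz))`
  obtain ⟨c, hc, hcT⟩ := exists_cycles_homologyMap_cross_kunnethComponent_π (sectionsSystem 𝓤 (unitModule X) ρX)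
    (sectionsSystem 𝓥 (unitModule Y) ρY) hab zy zz
  erw [hc]
  rw [← LinearMap.comp_apply, ← ModuleCat.hom_comp, HomologicalComplex.homologyπ_naturality, ModuleCat.hom_comp,
    LinearMap.comp_apply]
  -- right: the class of the cup product of the refined cycles
  rw [homologyπ_refineComplexMap, homologyπ_refineComplexMap, cupH_π]
  refine congrArg _ (OrderedCech.cycles_ext _ _ ?_)
  rw [iCycles_cupCycles (hβ := isNaturalPairing_mulPairing _ _) (h := h), iCycles_cyclesMap_refineComplexMap,
    iCycles_cyclesMap_refineComplexMap]
  change ((cyclesMap e.hom (n : ℤ) ≫ (cechComplex _ (unitModule Z) ρZ).iCycles (n : ℤ)).hom c) = _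
  rw [HomologicalComplex.cyclesMap_i, ModuleCat.hom_comp, LinearMap.comp_apply]
  have hcc : ((sysComplex (lexSystem (prodSystem (sectionsSystem 𝓤 (unitModule X) ρX) (sectionsSystem 𝓥 (unitModule Y) ρY)))).iCycles
      (n : ℤ)).hom c =
      crossComponent (prodSystem (sectionsSystem 𝓤 (unitModule X) ρX) (sectionsSystem 𝓥 (unitModule Y) ρY)) a b n
        (tensorCochainEquiv (sectionsSystem 𝓤 (unitModule X) ρX) (sectionsSystem 𝓥 (unitModule Y) ρY) a b
          (((cechComplex 𝓤 (unitModule X) ρX).iCycles (a : ℤ)).hom zy ⊗ₜ ((cechComplex 𝓥 (unitModule Y) ρY).iCycles (b : ℤ)).hom zz)) := by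
    funext T
    rw [hcT T, crossComponent_tensorCochainEquiv_tmul hab _ _ T]
  rw [hcc]
  exact cechUnit_iso_crossComponent_tmul_eq_cup_refineCochain hρZp hρZq 𝓤 𝓥 e ε he hε hab _ _

end Literature.AlgebraicGeometry.Modules

end
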